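import Summits.CriticalPhenomena.PercolationContinuityZ3.Theorems.PercNearOneGluingNoHeavyQuantFarTwoHubLaw
import Summits.CriticalPhenomena.PercolationContinuityZ3.Theorems.PercNearOneGluingNoHeavyQuantFarTwoAnchorBlock
import HarnessLib

/-!
# QUANT lane R8, front "FAR beyond trees", layer one — TWO-HUB BLOCKS III: the decoupled weights (the hubs ride along)

builds on p205010 (kernel theorem, internal audit signed; external expert review pending)

Support file (`--supports stmt-CriticalPhenomena-4575`), seat `prim-quant-p1` (gen 19); memo
`run/shared/lean/prim/quant/prim-quant-p1-g19/FOR-LEAD-CACTI.md` §5.  Standard axioms; no sorries; one definition (`Block.hdecouple`).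

Setting `Block.IsTwoHub c v₁ v₂ Z S₁ S₂`.  The HUB-DECOUPLED weights `Block.hdecouple … w` keep `w` off the block and on the hub pairs (pairs
inside `Sᵢ ∪ {vᵢ}` meeting `Sᵢ` — so whatever hangs at the anchors is untouched), join `c` to `vᵢ` by a single pair of weight
`mᵢ = P_w(c ↔ vᵢ in core)` and kill every other pair of the block: the 2-connected core is replaced by two stems, one block fewer, and nothing
has to be flattened.
* `Block.hdecouple` (+ value / vanishing lemmas: it hangs `Z` at `c` and `Sᵢ` at `vᵢ`);
* `Block.real_coreReach_hdecouple₁/₂`, `Block.real_coreReach_inter_hdecouple` — `P'(Eᵢ) = mᵢ`, `P'(E₁E₂) = m₁m₂`;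
* `Block.real_hub_hdecouple` — the hub laws agree; `Block.real_onReach_hub₁/₂` — internal marginal of `a ∈ Sᵢ` is `mᵢ · P(vᵢ ↔ a inside)`;
  `Block.real_onReach_anchor` — internal marginal of an anchor is `mᵢ`.
[cite: Grimmett1999, §1.3 p. 10; §2.2]; the theorems [this work].
-/

noncomputable section

namespace Summit.CriticalPhenomena.PercolationContinuityZ3.Theorems

namespace Quant

namespace Block

open Finset MeasureTheory Set
open Literature.Probability.LatticeModels
open Literature.Probability.Percolation
open Bundle (offZ avoid)
open scoped Classical

variable {n : ℕ}

/-- The HUB-DECOUPLED weights: `w` off the block and on the hub pairs, stems `s(c, vᵢ)` of weight `mᵢ = P_w(c ↔ vᵢ in core)`, else `0`. [this work] -/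
def hdecouple (c v₁ v₂ : Fin n) (Z S₁ S₂ : Finset (Fin n)) (w : Sym2 (Fin n) → unitInterval) : Sym2 (Fin n) → unitInterval := fun e =>
  if e ∈ avoid Z then w e
  else if e = s(c, v₁) then stem c v₁ Z (S₁ ∪ S₂) w
  else if e = s(c, v₂) then stem c v₂ Z (S₁ ∪ S₂) w
  else if e ∈ hubPairs S₁ v₁ ∨ e ∈ hubPairs S₂ v₂ then w e else 0

section TwoHub

variable {c v₁ v₂ : Fin n} {Z S₁ S₂ : Finset (Fin n)} (H : IsTwoHub c v₁ v₂ Z S₁ S₂) (w : Sym2 (Fin n) → unitInterval)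
include H

/-- A hub pair is not a stem. [this work] -/
theorem hub_ne_stem {e : Sym2 (Fin n)} (he : e ∈ hubPairs S₁ v₁ ∨ e ∈ hubPairs S₂ v₂) (v : Fin n) (hv : v ∉ S₁) (hv' : v ∉ S₂) :
    e ≠ s(c, v) := by
  rintro rfl
  rcases he with he | he
  · obtain ⟨⟨z, hz, hze⟩, -⟩ := (Finset.mem_filter.1 he).2
    rcases Sym2.mem_iff.1 hze with rfl | rfl
    · exact H.cZ (H.S₁Z hz)
    · exact hv hz
  · obtain ⟨⟨z, hz, hze⟩, -⟩ := (Finset.mem_filter.1 he).2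
    rcases Sym2.mem_iff.1 hze with rfl | rfl
    · exact H.cZ (H.S₂Z hz)
    · exact hv' hz

/-- A hub pair does not avoid `Z`. [this work] -/
theorem hub_not_avoid {e : Sym2 (Fin n)} (he : e ∈ hubPairs S₁ v₁ ∨ e ∈ hubPairs S₂ v₂) : e ∉ avoid Z := by
  intro h
  rcases he with he | he
  · obtain ⟨⟨z, hz, hze⟩, -⟩ := (Finset.mem_filter.1 he).2
    exact (Finset.mem_filter.1 h).2 z (H.S₁Z hz) hze
  · obtain ⟨⟨z, hz, hze⟩, -⟩ := (Finset.mem_filter.1 he).2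
    exact (Finset.mem_filter.1 h).2 z (H.S₂Z hz) hze

omit H in
/-- `hdecouple` agrees with `w` off the block. [this work] -/
theorem hdecouple_of_avoid {e : Sym2 (Fin n)} (he : e ∈ avoid Z) : hdecouple c v₁ v₂ Z S₁ S₂ w e = w e := by
  simp only [hdecouple, if_pos he]

/-- `hdecouple` on the first stem. [this work] -/
theorem hdecouple_stem₁ : hdecouple c v₁ v₂ Z S₁ S₂ w s(c, v₁) = stem c v₁ Z (S₁ ∪ S₂) w := by
  have h1 : s(c, v₁) ∉ avoid Z := fun h => (Finset.mem_filter.1 h).2 v₁ H.v₁Z (Sym2.mem_mk_right _ _)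
  simp only [hdecouple, if_neg h1, if_true]

/-- `hdecouple` on the second stem. [this work] -/
theorem hdecouple_stem₂ : hdecouple c v₁ v₂ Z S₁ S₂ w s(c, v₂) = stem c v₂ Z (S₁ ∪ S₂) w := by
  have h1 : s(c, v₂) ∉ avoid Z := fun h => (Finset.mem_filter.1 h).2 v₂ H.v₂Z (Sym2.mem_mk_right _ _)
  simp only [hdecouple, if_neg h1, if_neg (Ne.symm (fun h => (Sym2.eq_iff.1 h).elim (fun h2 => H.hne h2.2) (fun h1 => H.cZ (h1.1 ▸ H.v₂Z)) : s(c, v₁) ≠ s(c, v₂))), if_true]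

/-- `hdecouple` keeps the hub weights. [this work] -/
theorem hdecouple_hub {e : Sym2 (Fin n)} (he : e ∈ hubPairs S₁ v₁ ∨ e ∈ hubPairs S₂ v₂) : hdecouple c v₁ v₂ Z S₁ S₂ w e = w e := by
  simp only [hdecouple, if_neg (hub_not_avoid H he), if_neg (hub_ne_stem H he v₁ H.v₁S₁ H.v₁S₂),
    if_neg (hub_ne_stem H he v₂ H.v₂S₁ H.v₂S₂), if_pos he]

omit H in
/-- `hdecouple` vanishes on every other pair. [this work] -/
theorem hdecouple_zero {e : Sym2 (Fin n)} (h1 : e ∉ avoid Z) (h2 : e ≠ s(c, v₁)) (h3 : e ≠ s(c, v₂))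
    (h4 : ¬ (e ∈ hubPairs S₁ v₁ ∨ e ∈ hubPairs S₂ v₂)) : (hdecouple c v₁ v₂ Z S₁ S₂ w e : ℝ) = 0 := by
  simp only [hdecouple, if_neg h1, if_neg h2, if_neg h3, if_neg h4]; rfl

/-- The hub-decoupled weights hang the block at `c`. [this work] -/
theorem hdecouple_block_vanish :
    ∀ x y : Fin n, x ≠ y → x ∈ Z → y ∉ Z → y ≠ c → (hdecouple c v₁ v₂ Z S₁ S₂ w s(x, y) : ℝ) = 0 := by
  intro x y _ hx hy hyc
  refine hdecouple_zero w (not_avoid_of_mem hx) ?_ ?_ ?_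
  · intro h
    rcases Sym2.eq_iff.1 h with ⟨h1, -⟩ | ⟨-, h2⟩
    · exact H.cZ (h1 ▸ hx)
    · exact hyc h2
  · intro h
    rcases Sym2.eq_iff.1 h with ⟨h1, -⟩ | ⟨-, h2⟩
    · exact H.cZ (h1 ▸ hx)
    · exact hyc h2
  · rintro (he | he)
    · obtain ⟨-, hin⟩ := (Finset.mem_filter.1 he).2
      rcases hin y (Sym2.mem_mk_right x y) with h | h
      · exact hy (H.S₁Z h)
      · exact hy (h ▸ H.v₁Z)
    · obtain ⟨-, hin⟩ := (Finset.mem_filter.1 he).2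
      rcases hin y (Sym2.mem_mk_right x y) with h | h
      · exact hy (H.S₂Z h)
      · exact hy (h ▸ H.v₂Z)

/-- The hub-decoupled weights hang `S₁` at `v₁`. [this work] -/
theorem hdecouple_hub_vanish₁ :
    ∀ x y : Fin n, x ≠ y → x ∈ S₁ → y ∉ S₁ → y ≠ v₁ → (hdecouple c v₁ v₂ Z S₁ S₂ w s(x, y) : ℝ) = 0 := by
  intro x y _ hx hy hyv
  refine hdecouple_zero w (not_avoid_of_mem (H.S₁Z hx)) ?_ ?_ ?_
  · intro h
    rcases Sym2.eq_iff.1 h with ⟨h1, -⟩ | ⟨h1, -⟩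
    · exact H.cZ (h1 ▸ H.S₁Z hx)
    · exact H.v₁S₁ (h1 ▸ hx)
  · intro h
    rcases Sym2.eq_iff.1 h with ⟨h1, -⟩ | ⟨h1, -⟩
    · exact H.cZ (h1 ▸ H.S₁Z hx)
    · exact H.v₂S₁ (h1 ▸ hx)
  · rintro (he | he)
    · obtain ⟨-, hin⟩ := (Finset.mem_filter.1 he).2
      rcases hin y (Sym2.mem_mk_right x y) with h | h
      · exact hy h
      · exact hyv h
    · obtain ⟨⟨z, hz, hze⟩, hin⟩ := (Finset.mem_filter.1 he).2
      rcases hin x (Sym2.mem_mk_left x y) with h | h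
      · exact Finset.disjoint_left.1 H.disj hx h
      · exact H.v₂S₁ (h ▸ hx)

/-- The mirror image of the hub data with respect to `hdecouple`: the weights are unchanged. [this work] -/
theorem hdecouple_symm : hdecouple c v₂ v₁ Z S₂ S₁ w = hdecouple c v₁ v₂ Z S₁ S₂ w := by
  funext e
  have hst : ∀ v, stem c v Z (S₂ ∪ S₁) w = stem c v Z (S₁ ∪ S₂) w := fun v => by rw [Finset.union_comm]
  by_cases h0 : e ∈ avoid Z
  · simp only [hdecouple, if_pos h0]
  · by_cases h1 : e = s(c, v₁)
    · subst h1
      simp only [hdecouple, if_neg h0, if_true, if_neg (fun h => (Sym2.eq_iff.1 h).elim (fun h2 => H.hne h2.2) (fun h1 => H.cZ (h1.1 ▸ H.v₂Z)) : s(c, v₁) ≠ s(c, v₂)), hst]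
    · by_cases h2 : e = s(c, v₂)
      · subst h2
        simp only [hdecouple, if_neg h0, if_true, if_neg (Ne.symm (fun h => (Sym2.eq_iff.1 h).elim (fun h2 => H.hne h2.2) (fun h1 => H.cZ (h1.1 ▸ H.v₂Z)) : s(c, v₁) ≠ s(c, v₂))), hst]
      · simp only [hdecouple, if_neg h0, if_neg h1, if_neg h2, or_comm]

/-- The hub-decoupled weights hang `S₂` at `v₂`. [this work] -/
theorem hdecouple_hub_vanish₂ :
    ∀ x y : Fin n, x ≠ y → x ∈ S₂ → y ∉ S₂ → y ≠ v₂ → (hdecouple c v₁ v₂ Z S₁ S₂ w s(x, y) : ℝ) = 0 := by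
  rw [← hdecouple_symm H w]; exact hdecouple_hub_vanish₁ H.symm w

/-! ## The internal law under the hub-decoupled weights -/

omit H in
/-- The core pairs other than the stems carry hub-decoupled weight `0`. [this work] -/
theorem hdecouple_core_vanish :
    ∀ e ∈ (corePairs Z (S₁ ∪ S₂)).filter (fun e => e ≠ s(c, v₁) ∧ e ≠ s(c, v₂)), (hdecouple c v₁ v₂ Z S₁ S₂ w e : ℝ) = 0 := by
  intro e he
  obtain ⟨hc, h2, h3⟩ := Finset.mem_filter.1 he
  obtain ⟨⟨z, hz, hze⟩, hL⟩ := (Finset.mem_filter.1 hc).2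
  refine hdecouple_zero w (fun h => (Finset.mem_filter.1 h).2 z hz hze) h2 h3 ?_
  rintro (he' | he')
  · obtain ⟨⟨x, hx, hxe⟩, -⟩ := (Finset.mem_filter.1 he').2
    exact hL x (Finset.mem_union_left _ hx) hxe
  · obtain ⟨⟨x, hx, hxe⟩, -⟩ := (Finset.mem_filter.1 he').2
    exact hL x (Finset.mem_union_right _ hx) hxe

/-- Almost surely under the hub-decoupled weights, `c ↔ v₁ in core` iff the stem `s(c, v₁)` is open. [this work] -/
theorem coreReach_hdecouple_iff₁ {ω : BondConfig (Fin n)}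
    (hω : ∀ e ∈ (corePairs Z (S₁ ∪ S₂)).filter (fun e => e ≠ s(c, v₁) ∧ e ≠ s(c, v₂)), e ∉ ω) :
    core Z (S₁ ∪ S₂) ω ∈ openConn c v₁ ↔ s(c, v₁) ∈ ω := by
  have hcv : c ≠ v₁ := fun h => H.cZ (h ▸ H.v₁Z)
  constructor
  · intro h
    obtain ⟨p⟩ := (h : (openGraph (core Z (S₁ ∪ S₂) ω)).Reachable c v₁).symm
    cases p with
    | nil => exact absurd rfl hcv.symm
    | cons hadj p' =>
      rename_i x
      rw [openGraph_adj] at hadj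
      obtain ⟨⟨heω, hz, hL⟩, hne⟩ := hadj
      have hmem : s(v₁, x) ∈ corePairs Z (S₁ ∪ S₂) := Finset.mem_filter.2 ⟨Finset.mem_univ _, hz, hL⟩
      by_contra hno
      have h1 : s(v₁, x) ≠ s(c, v₁) := by
        intro h; rw [h] at heω; exact hno heω
      have h2 : s(v₁, x) ≠ s(c, v₂) := by
        intro h
        rcases Sym2.eq_iff.1 h with ⟨h3, -⟩ | ⟨h3, -⟩
        · exact hcv h3.symm
        · exact H.hne h3
      exact hω _ (Finset.mem_filter.2 ⟨hmem, h1, h2⟩) heω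
  · intro h
    have hadj : (openGraph (core Z (S₁ ∪ S₂) ω)).Adj c v₁ := by
      rw [openGraph_adj]
      refine ⟨⟨h, ⟨v₁, H.v₁Z, Sym2.mem_mk_right _ _⟩, fun ℓ hℓ hmem => ?_⟩, hcv⟩
      rcases Sym2.mem_iff.1 hmem with rfl | rfl
      · rcases Finset.mem_union.1 hℓ with h' | h'
        · exact H.cZ (H.S₁Z h')
        · exact H.cZ (H.S₂Z h')
      · rcases Finset.mem_union.1 hℓ with h' | h'
        · exact H.v₁S₁ h'
        · exact H.v₁S₂ h'
    exact hadj.reachable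

/-- `P_{w'}(c ↔ v₁ in core) = m₁` under the hub-decoupled weights. [this work] -/
theorem real_coreReach_hdecouple₁ :
    (prodBernoulli (hdecouple c v₁ v₂ Z S₁ S₂ w)).real {ω | core Z (S₁ ∪ S₂) ω ∈ openConn c v₁} =
      (prodBernoulli w).real {ω | core Z (S₁ ∪ S₂) ω ∈ openConn c v₁} := by
  rw [real_congr_of_vanish _ _ (hdecouple_core_vanish w) _ {ω | s(c, v₁) ∈ ω}
    (fun ω hω => by simp only [mem_setOf_eq]; exact coreReach_hdecouple_iff₁ H hω),
    prodBernoulli_real_setOf_mem, hdecouple_stem₁ H w]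
  rfl

/-- `P_{w'}(c ↔ v₂ in core) = m₂`. [this work] -/
theorem real_coreReach_hdecouple₂ :
    (prodBernoulli (hdecouple c v₁ v₂ Z S₁ S₂ w)).real {ω | core Z (S₁ ∪ S₂) ω ∈ openConn c v₂} =
      (prodBernoulli w).real {ω | core Z (S₁ ∪ S₂) ω ∈ openConn c v₂} := by
  have h := real_coreReach_hdecouple₁ H.symm w
  rw [hdecouple_symm H w, Finset.union_comm] at h
  exact h

/-- `P_{w'}(c ↔ v₁ and c ↔ v₂ in core) = m₁ m₂`. [this work] -/
theorem real_coreReach_inter_hdecouple :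
    (prodBernoulli (hdecouple c v₁ v₂ Z S₁ S₂ w)).real
        ({ω | core Z (S₁ ∪ S₂) ω ∈ openConn c v₁} ∩ {ω | core Z (S₁ ∪ S₂) ω ∈ openConn c v₂}) =
      (prodBernoulli w).real {ω | core Z (S₁ ∪ S₂) ω ∈ openConn c v₁} *
        (prodBernoulli w).real {ω | core Z (S₁ ∪ S₂) ω ∈ openConn c v₂} := by
  have hω2 : ∀ ω : BondConfig (Fin n), (∀ e ∈ (corePairs Z (S₁ ∪ S₂)).filter (fun e => e ≠ s(c, v₁) ∧ e ≠ s(c, v₂)), e ∉ ω) →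
      ∀ e ∈ (corePairs Z (S₂ ∪ S₁)).filter (fun e => e ≠ s(c, v₂) ∧ e ≠ s(c, v₁)), e ∉ ω := by
    intro ω hω e he
    obtain ⟨h1, h2, h3⟩ := Finset.mem_filter.1 he
    rw [Finset.union_comm] at h1
    exact hω e (Finset.mem_filter.2 ⟨h1, h3, h2⟩)
  have hiff₂ : ∀ ω : BondConfig (Fin n), (∀ e ∈ (corePairs Z (S₁ ∪ S₂)).filter (fun e => e ≠ s(c, v₁) ∧ e ≠ s(c, v₂)), e ∉ ω) →
      (core Z (S₁ ∪ S₂) ω ∈ openConn c v₂ ↔ s(c, v₂) ∈ ω) := by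
    intro ω hω
    have h := coreReach_hdecouple_iff₁ H.symm (hω2 ω hω)
    rw [Finset.union_comm] at h
    exact h
  rw [real_congr_of_vanish _ _ (hdecouple_core_vanish w) _ {ω | ((({s(c, v₁), s(c, v₂)} : Finset _) : Set (Sym2 (Fin n))) ⊆ ω)}
    (fun ω hω => by
      simp only [Set.mem_inter_iff, mem_setOf_eq, Finset.coe_insert, Finset.coe_singleton, Set.insert_subset_iff,
        Set.singleton_subset_iff]
      rw [coreReach_hdecouple_iff₁ H hω, hiff₂ ω hω]),
    prodBernoulli_real_subset, Finset.prod_pair (fun h => (Sym2.eq_iff.1 h).elim (fun h2 => H.hne h2.2) (fun h1 => H.cZ (h1.1 ▸ H.v₂Z)) : s(c, v₁) ≠ s(c, v₂)), hdecouple_stem₁ H w, hdecouple_stem₂ H w]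
  rfl

/-- The hub laws are the same under `w` and the hub-decoupled weights (hub 1). [this work] -/
theorem real_hub_hdecouple₁ (B : Finset (Fin n)) (P : ℕ → Prop) :
    (prodBernoulli (hdecouple c v₁ v₂ Z S₁ S₂ w)).real {ω | P ((B.filter fun a => inS S₁ v₁ ω ∈ openConn v₁ a).card)} =
      (prodBernoulli w).real {ω | P ((B.filter fun a => inS S₁ v₁ ω ∈ openConn v₁ a).card)} :=
  prodBernoulli_real_eq_of_determinedBy _ _ (fun _ he => hdecouple_hub H w (Or.inl (Finset.mem_coe.1 he))) (determinedBy_hub S₁ v₁ B P)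
    (Set.toFinite _).measurableSet

/-- The hub laws are the same under `w` and the hub-decoupled weights (hub 2). [this work] -/
theorem real_hub_hdecouple₂ (B : Finset (Fin n)) (P : ℕ → Prop) :
    (prodBernoulli (hdecouple c v₁ v₂ Z S₁ S₂ w)).real {ω | P ((B.filter fun a => inS S₂ v₂ ω ∈ openConn v₂ a).card)} =
      (prodBernoulli w).real {ω | P ((B.filter fun a => inS S₂ v₂ ω ∈ openConn v₂ a).card)} :=
  prodBernoulli_real_eq_of_determinedBy _ _ (fun _ he => hdecouple_hub H w (Or.inr (Finset.mem_coe.1 he))) (determinedBy_hub S₂ v₂ B P)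
    (Set.toFinite _).measurableSet

/-- Events read off the inner pairs of hub 1 have the same probability under `w` and the hub-decoupled weights. [this work] -/
theorem real_inS_hdecouple₁ (P : BondConfig (Fin n) → Prop) :
    (prodBernoulli (hdecouple c v₁ v₂ Z S₁ S₂ w)).real {ω | P (inS S₁ v₁ ω)} = (prodBernoulli w).real {ω | P (inS S₁ v₁ ω)} :=
  prodBernoulli_real_eq_of_determinedBy _ _ (fun _ he => hdecouple_hub H w (Or.inl (Finset.mem_coe.1 he))) (determinedBy_inS S₁ v₁ P)
    (Set.toFinite _).measurableSet

/-- Events read off the inner pairs of hub 2 have the same probability under `w` and the hub-decoupled weights. [this work] -/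
theorem real_inS_hdecouple₂ (P : BondConfig (Fin n) → Prop) :
    (prodBernoulli (hdecouple c v₁ v₂ Z S₁ S₂ w)).real {ω | P (inS S₂ v₂ ω)} = (prodBernoulli w).real {ω | P (inS S₂ v₂ ω)} :=
  prodBernoulli_real_eq_of_determinedBy _ _ (fun _ he => hdecouple_hub H w (Or.inr (Finset.mem_coe.1 he))) (determinedBy_inS S₂ v₂ P)
    (Set.toFinite _).measurableSet

/-- Internal marginal of a hub vertex (hub 1): `P_v(c ↔ a on Z) = P_v(c ↔ v₁ in core) · P_v(v₁ ↔ a inside)`. [this work] -/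
theorem real_onReach_hub₁ (v : Sym2 (Fin n) → unitInterval)
    (hv₁ : ∀ x y : Fin n, x ≠ y → x ∈ S₁ → y ∉ S₁ → y ≠ v₁ → (v s(x, y) : ℝ) = 0)
    (hv₂ : ∀ x y : Fin n, x ≠ y → x ∈ S₂ → y ∉ S₂ → y ≠ v₂ → (v s(x, y) : ℝ) = 0) {a : Fin n} (ha : a ∈ S₁) :
    (prodBernoulli v).real {ω | onZ Z ω ∈ openConn c a} =
      (prodBernoulli v).real {ω | core Z (S₁ ∪ S₂) ω ∈ openConn c v₁} * (prodBernoulli v).real {ω | inS S₁ v₁ ω ∈ openConn v₁ a} := by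
  rw [real_congr_of_good₂ v hv₁ hv₂ _ ({ω | core Z (S₁ ∪ S₂) ω ∈ openConn c v₁} ∩ {ω | inS S₁ v₁ ω ∈ openConn v₁ a})
    (fun ω hω => by simp only [Set.mem_inter_iff, mem_setOf_eq]; exact on_reach_hub_iff₁ H hω.1 hω.2 ha)]
  have h := real_core_hub₁ H v (determinedBy_core Z (S₁ ∪ S₂) fun η => η ∈ openConn c v₁)
    (determinedBy_hub S₁ v₁ {a} fun k => 1 ≤ k)
  have e : {ω : BondConfig (Fin n) | 1 ≤ (({a} : Finset (Fin n)).filter fun a' => inS S₁ v₁ ω ∈ openConn v₁ a').card} =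
      {ω | inS S₁ v₁ ω ∈ openConn v₁ a} := by
    ext ω
    simp only [mem_setOf_eq, Finset.filter_singleton]
    by_cases hr : inS S₁ v₁ ω ∈ openConn v₁ a
    · simp only [hr, if_true, Finset.card_singleton, le_refl]
    · simp only [hr, if_false, Finset.card_empty, Nat.le_zero, one_ne_zero]
  rw [e] at h
  exact h

/-- Internal marginal of a hub vertex (hub 2). [this work] -/
theorem real_onReach_hub₂ (v : Sym2 (Fin n) → unitInterval)
    (hv₁ : ∀ x y : Fin n, x ≠ y → x ∈ S₁ → y ∉ S₁ → y ≠ v₁ → (v s(x, y) : ℝ) = 0)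
    (hv₂ : ∀ x y : Fin n, x ≠ y → x ∈ S₂ → y ∉ S₂ → y ≠ v₂ → (v s(x, y) : ℝ) = 0) {a : Fin n} (ha : a ∈ S₂) :
    (prodBernoulli v).real {ω | onZ Z ω ∈ openConn c a} =
      (prodBernoulli v).real {ω | core Z (S₁ ∪ S₂) ω ∈ openConn c v₂} * (prodBernoulli v).real {ω | inS S₂ v₂ ω ∈ openConn v₂ a} := by
  have h := real_onReach_hub₁ H.symm v hv₂ hv₁ ha
  rw [Finset.union_comm] at h
  exact h

/-- Internal marginal of an anchor (or any non-hub block vertex): `P_v(c ↔ y on Z) = P_v(c ↔ y in core)`. [this work] -/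
theorem real_onReach_anchor (v : Sym2 (Fin n) → unitInterval)
    (hv₁ : ∀ x y : Fin n, x ≠ y → x ∈ S₁ → y ∉ S₁ → y ≠ v₁ → (v s(x, y) : ℝ) = 0)
    (hv₂ : ∀ x y : Fin n, x ≠ y → x ∈ S₂ → y ∉ S₂ → y ≠ v₂ → (v s(x, y) : ℝ) = 0) {y : Fin n} (hy₁ : y ∉ S₁) (hy₂ : y ∉ S₂) :
    (prodBernoulli v).real {ω | onZ Z ω ∈ openConn c y} = (prodBernoulli v).real {ω | core Z (S₁ ∪ S₂) ω ∈ openConn c y} :=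
  real_congr_of_good₂ v hv₁ hv₂ _ _ fun ω hω => by simp only [mem_setOf_eq]; exact on_reach_iff_hubCore H hω.1 hω.2 hy₁ hy₂

end TwoHub

end Block

end Quant

end Summit.CriticalPhenomena.PercolationContinuityZ3.Theorems
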